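import Mathlib
import HarnessLib
import HarnessLib.Audit
import Summits.ABC.Statement

/-!
Route: RootDecompI

DORMANT since 2026-09-04T10:18:01Z (reconciler: no traction for 5 d (last activity item-evidence-added at 2026-08-30T09:15:49Z); parked, not closed — `ledger route dormant route-ABC-RootDecompI --off` to reactivate) — unstaffed, not closed; items shared with open routes are served there. `ledger route dormant <id> --off` reactivates.

# Route RootDecompI — abc splits exactly into deep-tame-forgiven abc (residual) and abc on the
deep-tame cells, the depth-tied tame excess of Stewart–Yu's cheap places as currency

It suffices to show X = DeepTameForgivenABC ∧ DeepTameHeavyABC (ninth root OR-node of cell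
decomp-abc, D-0178; lens 3 «linear forms in
logarithms, quantitative», generation 7; no card realised). Currency: for an abc triple T = (a,b,c)
and δ > 0 the DEPTH-TIED TAME EXCESS
Q_δ(T) := ∏_{p | abc, p ≤ ⌊rad(abc)^δ⌋} p^{(ν_p(abc) − ⌈1/δ⌉)⁺} — the part of abc carried by TAME
primes (the cheap places of Yu's p-adic bound,
p ≤ rad^δ, where the factor p^d costs only rad^{O(δ)}) BEYOND DEPTH ⌈1/δ⌉. W = DeepTameForgivenABC
(crux r2, population-free, FORGIVEN, the
declared RESIDUAL / summit-carrying leaf): ∀δ>0 ∃K ∀ abc triples: c < K·Q_δ(T)·rad^{1+δ}. H =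
DeepTameHeavyABC (crux r3, the attacked conjunct):
∀δ>0 ∃K ∀ abc triples with c^δ ≤ Q_δ(T): c < K·rad^{1+δ} (abc on the deep-tame cells). EXACT: ABC ⟺
W ∧ H (kernel `node_iff` in the lens file
DeepTameSplit.lean; deciding theorem `closes : W → H → ABC`, 60 lines: at tolerance ε test c^{ε/3} ≤
Q_{ε/3}(T); inside, H at δ = ε/3; outside,
W gives c < K·c^{ε/3}·rad^{1+ε/3} and root extraction gives c < K^{1/(1−ε/3)}·rad^{(1+ε/3)/(1−ε/3)}
≤ K'·rad^{1+ε}); necessity of both pieces is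
kernel (Q_δ ≥ 1). The in-cone RUNG of H, DeepTameHeavySubexp (log c ≪ rad^{δ+ε} on the cell), is
PROVED (kernel from route A's aside stmt-ABC-26556
and unconditionally in the companion TameExcessSplitRung.lean) and is filed as an aside (outside the
cone of `closes`, BC6).
Lean: `(∀ δ : ℝ, 0 < δ → ∃ K : ℝ, 0 < K ∧ ∀ a b c : ℕ,
Literature.NumberTheory.DiophantineGeometry.IsABCTriple a b c → (c : ℝ) < K * ((∏ p ∈ (a * b *
c).primeFactors with p ≤ ⌊((Literature.NumberTheory.DiophantineGeometry.rad a b c : ℕ) : ℝ) ^ δ⌋₊, p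
^ ((a * b * c).factorization p - ⌈δ⁻¹⌉₊) : ℕ) : ℝ) *
((Literature.NumberTheory.DiophantineGeometry.rad a b c : ℕ) : ℝ) ^ (1 + δ)) ∧ (∀ δ : ℝ, 0 < δ → ∃ K
: ℝ, 0 < K ∧ ∀ a b c : ℕ, Literature.NumberTheory.DiophantineGeometry.IsABCTriple a b c → (c : ℝ) ^
δ ≤ ((∏ p ∈ (a * b * c).primeFactors with p ≤ ⌊((Literature.NumberTheory.DiophantineGeometry.rad a b
c : ℕ) : ℝ) ^ δ⌋₊, p ^ ((a * b * c).factorization p - ⌈δ⁻¹⌉₊) : ℕ) : ℝ) → (c : ℝ) < K *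
((Literature.NumberTheory.DiophantineGeometry.rad a b c : ℕ) : ℝ) ^ (1 + δ))`

## Assembly
Sixty lines of real-exponent bookkeeping (glue.lean `closes`; kernel `closes` / `node_iff` in the
lens file, std axioms): reduce to ε ≤ 1 (ε ↦ min ε 1,
rad ≥ 1); given ε take K₁ from H at δ = ε/3 and K₂ from W at δ = ε/3 and set K := max K₁
(K₂^((1−ε/3)⁻¹)); for a triple test the cell condition
c^(ε/3) ≤ Q_(ε/3)(T): inside, H gives c < K₁·rad^(1+ε/3) ≤ K·rad^(1+ε); outside, Q < c^(ε/3) and W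
give c < K₂·c^(ε/3)·rad^(1+ε/3), hence
c^(1−ε/3) < K₂·rad^(1+ε/3) and c < K₂^(1/(1−ε/3))·rad^((1+ε/3)/(1−ε/3)) ≤ K·rad^(1+ε) because
(1+ε/3)/(1−ε/3) ≤ 1+ε for 0 < ε ≤ 1. No literature fact
is used. Both directions hold: ABC ⟹ W ∧ H (Q_δ ≥ 1; kernel `deepTameForgiven_of_abc`,
`deepTameHeavy_of_abc`).

Rationale: WHY THIS LINE. Stewart–Yu / Yu: the p-adic linear-form bound at the place p carries the factor
p^d·(product of heights); at TAME places p ≤ rad^δ this factor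
is ≤ rad^{dδ} — cheap — so Baker's method reaches log c ≪ rad^{O(δ)} on any cell where the tame
places carry a fixed power of c (route A's
CheapHeavySubexp, stmt-ABC-26556, PROVED; StewartYu2001 Thm 1–2, Yu2007, Pasten2024). Route A (gen
4) cut by tame MASS and the lens's gen-7 draft
cut by depth-1 tame EXCESS; both cells are entered generically by degree-2 identity maps, so an
UNFORGIVEN abc conclusion on them is the summit
in costume — kernel-certified here for depth 1: `tameExcessHeavy_transport : TameExcessHeavyABC →
OuterTameMassPoly` (squaring T ↦ (a², b(c+a), c²)
converts tame mass into tame excess), i.e. PolyABC(θ) ∀θ > 1 generically. The node cuts by tame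
excess AT DEPTH > 1/δ: the only structure a
polynomial identity map cannot manufacture is MULTIPLICITY — a degree-d map multiplies
multiplicities by ≤ d and adds O(1) — so a cell asking for
multiplicity > 1/δ carrying c^δ is reachable only from triples that already have a tame tower of
depth ≳ 1/(dδ); as δ → 0 these entry layers
shrink to ∅ (instrument: deep-cell entry of light hits 100/93.8/84.8/63.5/45.0/30.3/8.1 % at δ =
1/2…1/64 vs ≈ 100 % for the depth-1 cell;
generic coprime pairs < 10⁹: 0–1.2 % vs 99.9 %; deep-tame-profile-gen7.tsv §B/§C/§F). The W side
forgives exactly that deep tame part, so W is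
population-free, monotone in δ, DECIDED at δ ≥ 1 (kernel `deepTameForgivenAt_of_one_le`, K = 2) and
implies route D's BoundedExponentABC (kernel
`boundedExponent_of_deepTameForgiven`: bounded-exponent cells carry no deep tame excess). Imported:
p-adic linear forms in logarithms at cheap
places (Yu2007), Stewart–Yu summation (StewartYu2001), Kummer descent / two-logarithm sharpenings
(BugeaudLaurent1996, BakerWustholz2007) for H's
next rung; truncated counting functions (Vojta1987, Pasten2024) as the nearest print notion. What no
prior route does: forgive or condition on a
DEPTH-TRUNCATED tame quantity — A: fixed-scale smooth mass (the fixed-scale excess version is ≡ A up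
to the primorial constant y#), D/H: top
exponent / Serre level (position- and prime-size-blind); Q is tame-only and truncates multiplicity
from ABOVE at the small primes, complementary
to Vojta's truncation from below.

RANKED CRUXES. #2 DeepTameForgivenABC (crux) — for every δ > 0 there is K = K(δ) > 0 such that EVERY
abc triple satisfies c < K · Q_δ(T) · rad(abc)^(1+δ), Q_δ(T) = ∏ over primes p | abc with p ≤
⌊rad(abc)^δ⌋ of p^(ν_p(abc) − ⌈1/δ⌉)⁺ (deep-tame-forgiven abc; piece W, population-free; the
declared RESIDUAL: W ⟹ RootDecompD.BoundedExponentABC in kernel, W(δ) decided for δ ≥ 1, open for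
every δ < 1). [difficulty: open-problem] (why it might fail: cannot fail unless abc fails (kernel
deepTameForgiven_of_abc); as a TARGET it contains abc on every bounded-exponent cell (D's
BoundedExponentABC, first open cell k = 3: Thue–Mahler territory) and on wild towers c = pⁿu, p >
rad^δ; W(δ) is open for every δ < 1.) [StewartYu2001, Yu2007, BombieriGubler2006, Granville1998,
Pasten2024, EvertseGyory2015]
#3 DeepTameHeavyABC (crux) — for every δ > 0 there is K = K(δ) > 0 such that every abc triple with
c^δ ≤ Q_δ(T) (a tame tower of depth > 1/δ carries c^δ) satisfies c < K · rad(abc)^(1+δ) — abc ON THE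
DEEP-TAME CELLS (piece H, the attacked conjunct; order-protected against identity-map re-entry;
inhabited by the infinite hit family (1, 2^(6k) − 1, 2^(6k)); rung DeepTameHeavySubexp PROVED).
[difficulty: open-problem] (why it might fail: cannot fail unless abc fails (kernel); as a TARGET it
contains MersenneRad-strength statements (abc on (1, 2ⁿ−1, 2ⁿ); Stewart 2013 gives far less) and the
lift of the proved rung exp(K·rad^(δ+ε)) ↦ K·rad^(1+δ) sits inside BakerMethodBounds unless the
depth > 1/δ of one cheap place is used.) [StewartYu2001, Yu2007, Stewart2013, BugeaudLaurent1996,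
Pasten2024, BakerWustholz2007]
#9 DeepTameHeavySubexp (support) — NAMED RUNG of H, PROVED: for every δ > 0 and ε > 0 there is K
with log c < K · rad(abc)^(δ+ε) for every abc triple with c^δ ≤ Q_δ(T). Kernel:
RootDecompA.CheapHeavySubexp (stmt-ABC-26556) ⟹ it (DeepTameSplit.lean
`deepTameHeavySubexp_of_cheapHeavySubexp`, cell inclusion Q_δ ≤ E_δ ≤ S_δ) and UNCONDITIONALLY
TameExcessSplitRung.lean `deepTameHeavySubexp_unconditional` (Stewart–Yu place bounds via
Summit.ABC.StewartYu.KummerThird + Theorems PadicPrimesKummerThirdY07Odd/Two; lean check rc 0 · 0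
sorry · axioms propext/Classical.choice/Quot.sound). Strictly below S's decided regime for δ + ε <
1/3; the cell is infinite. Filed as an ASIDE at birth (outside the cone of closes, BC6); a prover
lands the companion under Summits/ABC/ABC/Theorems/ with --supports. [difficulty: provable-now]
[StewartYu2001, Yu2007]

TWO-LAYER PLAN. Foreseen, NOT filed now (D-0019): H ⇐ DeepTameHeavyQuasi (log c ≪_δ,A (log rad)^A on
the cell {c^δ ≤ Q_δ}, the depth-sensitive one-place bound: ONE cheap
prime p ≤ rad^δ with ν_p > 1/δ carries c^δ, so the p-adic linear form has p^d ≤ rad^(dδ) and a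
single dominant logarithm — Bugeaud–Laurent two-log
sharpenings, Kummer descent as in the tree's SingleTowerSzpiro / KummerThird) → a polynomial lift on
the cell; W ⇐ (W on wild towers c = pⁿu, p > rad^δ:
route H's NontrivialLevelFloor covers q^p | abc, p large) + (W on shallow triples: route D's
BoundedExponentABC ladder k = 3 ⟸ UniformBinomialCubicThue,
asides stmt-ABC-25611/25612) — both kinships are kernel edges in the lens file (§5/§7), to be
promoted to a glued split only after the root clears the
critic's registry and the tribunal.

KILL CRITERIA. No refutation of W or H is possible without refuting abc (both are kernel
consequences of ABC: `deepTameForgiven_of_abc`, `deepTameHeavy_of_abc`), so a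
refuted item closes the SUMMIT, not just the route. The route is retired `not-a-thesis` / superseded
if (i) the tribunal reads H (the attacked conjunct)
as summit-strength — i.e. exhibits generic ENTRY into the deep cell {c^δ ≤ Q_δ(T)} for every δ by
some identity map of bounded degree (the lens's
R-REENTRY battery says no: entry needs an existing tame tower with p^(ν−⌈1/δ⌉/d) ≥ c^δ; a kernel
transport theorem `DeepTameHeavyABC → PolyABC(θ)`
for some fixed θ on a generic population would kill it exactly as `tameExcessHeavy_transport` killed
the depth-1 draft); (ii) the critic's registry
rules the node a COSTUME of route A's door (CheapMassSplit: fixed-scale smooth mass) — the lens's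
answer: the fixed-scale excess version is ≡ A up to y#,
the δ-tied depth-1 version is dead (kernel), the δ-tied depth-⌈1/δ⌉ version is this node and W ⟹ D's
BoundedExponentABC which A's F_A does not give;
(iii) a proof of MersenneRad-type statements making H's cell free would moot H (then W ≡ S and the
door collapses to the residual).

NOT DECOMPOSED YET. The next rung of H (DeepTameHeavyQuasi, IDEA-NEEDED: inside BakerMethodBounds
unless the depth at ONE cheap place is used) and every split of W
(wild towers / shallow triples) are deliberately not items: the root must clear the critic
(registry: ORDER-PROTECTION LAW, depth × tolerance ≥ 1)
and the pre-birth tribunal first; constants K(δ), the choice δ = ε/3 in `closes`, and the cell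
inclusions Q_δ ≤ E_δ ≤ S_δ are bookkeeping, not items.
The audit-exhibit decls of the lens file (TameExcessHeavyABC, OuterTameMassPoly: the DEAD depth-1
cut and its transport image) are NOT items.

CHEAPEST FALSIFIER. Generic ENTRY into the deep cell: exhibit an identity map M of degree d ≤ 3 from
the census menu (M_b = (a², 4bc, (a+2b)²), M_a, Q1 = ((b−a)², 4ab, c²),
T2a = (a², b(c+a), c²), T2b, φ₃, T3a, 2-chains) under which a positive proportion of generic coprime
pairs (a, b) < 10⁹ lands in {c^δ ≤ Q_δ} for
δ = 1/16, 1/24, 1/32 — the lens ran it (deep-tame-profile-gen7.tsv §F, 1500 generic pairs per δ):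
deep-cell entry 6 · 13 · 17 · 4 · 0 · 0 · 0 of
1500 at δ = 1/2, 1/4, 1/8, 1/16, 1/24, 1/32, 1/64 (vs 1498–1500 of 1500 for the depth-1 cell, which
is why the depth-1 draft is dead). A kernel
version (a transport theorem into the deep cell at a fixed δ for all large triples) kills H as a
genuine piece. Second cheapest: the W-slack census
(§A: max log(c/(Q·rad^(1+δ)))/log rad = −0.52, 0.08, 0.44, 0.57, 0.61 at δ = 1/2, 1/4, 1/8, 1/16,
1/64 over 20185 hits) — W needs K(δ) growing like
abc's: it is honestly the summit-carrying leaf, declared residual.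

NUMBERS. Stewart–Yu 2001 Thm 1: log c < K_ε·rad^(1/3+ε) (the global Baker ceiling,
Literature/Barriers/ABC/BakerMethodBounds.lean shape (1/3, 3)); Thm 2 / Pasten 2024
(1.2): c < exp(p′·R^(κ/log log R)) with p′ = min over the members of the largest prime — the
cheap-place philosophy at ONE member. Deep-cell population
of the 20185 known high-quality hits (census input columns_KNOWN_UNION_HITS, sha256 c5832622…): 98.2
/ 89.6 / 65.6 / 30.8 / 14.0 / 7.8 / 0.07 % at
δ = 1/2, 1/4, 1/8, 1/16, 1/24, 1/32, 1/64 (241/240/210/111/52/22/0 of the 241 hits with quality >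
1.4); Reyssat's 2 + 3¹⁰·109 = 23⁵ lies in the cell at
δ = 1/8 (3^(10−8) = 9 ≥ c^(1/8) ≈ 7.1) and outside at δ = 1/16. Mersenne family (1, 2^(6k) − 1,
2^(6k)) in the cell for k ≥ k₀(δ) = 1, 1, 2, 4 at
δ = 1/2, 1/4, 1/8, 1/16. Rung regime: log c ≪ rad^(δ+ε) on the cell, new for δ + ε < 1/3.

DEFINITION REQUESTS. None: Q_δ(T) is inlined in every item as a Finset product over
(a·b·c).primeFactors (no new notion); the rung's landing under Theorems/ needs the
imports Summits.ABC.StewartYu.KummerThirdDoor +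
Summits.ABC.ABC.Theorems.PadicPrimesKummerThirdY07Odd/Two exactly as stmt-ABC-26556's
CheapMassSplitRung.
Cite fact wanted: none new (StewartYu2001 / Yu2007 place bounds are already typed under
Literature.NumberTheory.DiophantineGeometry.AbcStewartYu2001*).

Workshop record (writer decomp-abc-writer-1-g3, cell decomp-abc, LADDER-abc rung 0, D-0178): this is
root node DeepTameSplit of lens lens-3 «linear forms in logarithms, quantitative» generation 7 (NODE
2026-08-30T05:59:00Z HOME/STATUS.md l.362, RESULT/DONE l.363; lens draft file DeepTameSplit.lean
sha256 597c8a9f2a895f3be40d542923ed2014f12c49387029e92662bbc7d51cc4291c, 690 lines, 0 sorry, axioms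
std; companion TameExcessSplitRung.lean sha256
0023e589f8b2b00a93aad65b31db496b7a06b3f2ec881473c2de4b89d9c95911 (rung
deepTameHeavySubexp_unconditional, 0 sorry, std axioms); NODE-g7.md sha256
fba8839f2f7fd9ae9a0dacad229db1f26751011a2ea3d8d4da0ac2af33a60524; items children7.json sha256
fd3382ad0ceea26c3ae8fe844665916e84fd7c670e9b1a423c14066c0b32cd1b; instruments
deep-tame-profile-gen7.tsv sha256 f7c3063fa230a17bafe74549c00fc18827bb60d39fb6ef7a9de806b5e1b8b0db,
menu-entry-gen7.tsv sha256 3e529bb5a8bc4925b9653b934afc5b516748847a242225935c886f69c50c2f01, BC7 raw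
bc/probe-raw-g7.txt sha256 6ba6ac660788d20d4580cb296481404abbc5314db1cd7b6c915628bd89427299; cell
census of record COSTUME-CENSUS-v6.md sha256
2cdd62f8ef2f57f07a6de16574c49cade514a108aecfe93cf8656bbe64b6d7f5 / .json
353996fb422aa5e40daa78a45d1f890d2c068689d6a8ab0ca6a62cde17cfd4d8, instrument ANSWERS-g6.md sha256
b9a5e092816e73c0b84c4a2cbb20fb2825cefba27d1e7729a487dbf938fe29ed), adopted as OR-sibling RootDecompI
of the root decomposition (ninth route file of the cell; siblings RootDecompA–H; DOOR PLACEMENT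
(critic n3): a CROSSING re-cut of door A (CheapMassSplit) — F_A 23784 ⟹ W and H ⟹ H_A 23785 on paper
(residual SMALLER than F_A, road LARGER than H_A: the deep towers at growing tame primes p ≤ rad^δ
move to the road), NOT a lineage/domination case; W ⟹ RootDecompD.BoundedExponentABC stmt-ABC-25609
in kernel, W ⊥ NLF 27945, H ⊥ NLF, W incomparable with A's live residual 27608 ⇒ DISTINCT door
(score 0: THIN-ROAD ∧ FAT-RESIDUAL, precedent A gen 0); H's rung DeepTameHeavySubexp ⟸ A's aside
CheapHeavySubexp stmt-ABC-26556 in kernel (INHERITED rung, critic n1: provers land 26556 / the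
companion chain once under Theorems/ and derive both); A's closes untouched); writer re-check
I7/DeepTameSplit_check.lean (lens file + Iff.rfl ×3 on the item texts + kernel facts by name) lean
check rc 0 · 0 sorry · std axioms; critic CLEARED decomp-abc-crit-1-g2 2026-08-30T06:21:59Z
(HOME/STATUS.md l.378): own lean_check of DeepTameSplit.lean and TameExcessSplitRung.lean rc0 · 0
sorry · std axioms («rung PROVED unconditionally» CONFIRMED in kernel, no fact hypotheses); item
texts = node defs verbatim ×3; closes ROOT-typed; GUARDS: exact ∧ node_iff ✓, NEC ×2 kernel ✓, no
EQUIV layer ✓, T1 no range split (W(δ) monotone, decided only at δ ≥ 1 inside S's free regime —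
correctly not a BC5 witness; H-cells shrink as δ → 0) ✓, R-FLAT n/a ✓, R-EMPTY (a)(b)(c) ✓✓✓,
R-REENTRY / R-TRANSPORT re-derived independently of the census (Mason–Stothers count: EXIT
impossible — forgiveness travels, R-FORGIVEN ✓; ENTRY needs pre-existing depth ≥ 2 and returns only
fixed exponents ν/(ν−1), never 1+ε ∀ε ⇒ H NOT COSTUME, ORDER-PROTECTED ✓) and ADOPTED as registry
heuristic R-DEPTH; depth-1 kill tameExcessHeavy_transport kernel ✓ (audit exhibit, not an item);
notes (none blocking): n1 rung INHERITED from 26556 (adds no Baker content beyond it; H's next rung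
IDEA-NEEDED), n2 BC8 caution — c^δ ≤ Q_δ is DISTRIBUTED over ≤ π(rad^δ) tame places, the advertised
one-place lift must handle distributed depth or reduce to a one-place sub-cell, n3 door placement
(above), n4 text nit on W(1/2), n5 novelty new-combination as claimed; tally g2 CLEARED 1 /
OBJECTION 0; per-piece tags: DeepTameForgivenABC WEAKER · population-free · IDEA-NEEDED
summit-carrying leaf = DECLARED RESIDUAL (tribunal_fit.residual), dial decided δ ≥ 1;
DeepTameHeavyABC WEAKER · ORDER-PROTECTED · ATTACKABLE (rung PROVED unconditionally) = the attacked
conjunct; DeepTameHeavySubexp aside PROVED (prover lane: land the companion under Theorems/ with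
--supports); pre-birth tribunal pre-check (writer): --quick and --full PROVISIONAL (t1_kernel clean
×2, t1r residual declared not-joint, t3k absent ⇒ plan-only until the companion lands, t4_cli placed
BakerMethodBounds). WHY THIS IS NOVEL: it is the first route in the tree to forgive / condition on a
DEPTH-TRUNCATED tame quantity — multiplicity truncated from ABOVE at the primes below rad^δ with the
depth m = ⌈1/δ⌉ tied to the exponent tolerance — giving an exact two-piece decomposition of abc
whose heavy side carries a proved unconditional Baker rung (log c ≪ rad^(δ+ε) on the cell, new for δ
+ ε < 1/3) and is transport-robust by a depth law (entry into {c^δ ≤ Q_δ} by a degree-d identity map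
needs an existing tame tower with p^(ν − m/d) ≥ c^δ), while the depth-1 and fixed-scale variants are
certified dead / ≡ route A in kernel (tameExcessHeavy_transport; E_y·y# ≥ S_y); nearest print
notions (Vojta's truncated counting functions, Stewart–Yu Thm 2's cheap place at one member)
truncate from below or use one member only. IUT is not cited.

Novelty: Searches (2026-08-30, lens seat + writer): lit search --hybrid "abc conjecture truncated counting
function truncation level multiplicity" → [corpus:book:vojta1987-diophantine-approximations
p.63,55], [corpus:paper:pasten2025-arithmetic-case-vojta-s-conjecture-with-truncated p.1–4]
(truncation from BELOW min(ν, m); Cor. 1.3 subexponential abc; (1.2) Stewart–Yu p′-bound),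
[corpus:book:bombieri2006 p.475,393], [corpus:book:evertse2015 p.87–88]; lit vsearch "<W in prose>"
→ the same + [corpus:book:baker2007 p.49–50]; lit galaxy search "truncated counting
function|truncation level|powerful part" --star pdf → 8 non-mathematical hits (null); in tree: TREE
v14.3 of cell decomp-abc (six doors A–H), ledger negatives --problem ABC (nothing on depth-truncated
tame products).
Nearest prior art found: in tree route-ABC-RootDecompA (lens 3 gen 4, CheapMassSplit: fixed-scale
smooth mass F_A/H_A; its aside stmt-ABC-26556 CheapHeavySubexp is this node's rung source) and
route-ABC-RootDecompD / route-ABC-RootDecompH (top exponent / Serre level; W ⟹ D's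
BoundedExponentABC in kernel); in print Vojta1987 truncated counting functions (below-truncation)
and StewartYu2001 Thm 2 / Pasten2024 (1.2) (cheap place at one member), Yu2007 (p-adic logarithmic
forms with the p^d factor).
Delta: truncation of multiplicity from ABOVE at the primes below rad^δ, with the depth tied to the
exponent tolerance (m = ⌈1/δ⌉), as the forgiven / conditioned currency of an exact two-piece
decomposition of abc whose heavy  [refs: book:vojta1987-diophantine-approximations, paper:pasten2025-arithmetic-case-vojta-s-conjecture-with-truncated, book:bombieri2006, book:evertse2015, book:baker2007, Vojta1987, StewartYu2001, Pasten2024, Yu2007]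

Barriers (technique_class: p-adic-linear-forms, cheap-places, depth-truncation): - technique_class: p-adic-linear-forms, cheap-places, depth-truncation
- Literature.Barriers.ABC.BakerMethodBounds: DeepTameHeavyABC's LIFT (subexp rung → polynomial) is
INSIDE the technique class and requires beating the barrier WITH a how: the cell supplies ONE cheap
place p ≤ rad^δ of depth ν_p > 1/δ carrying c^δ, so the p-adic linear form has p^d ≤ rad^(dδ) and a
single dominant logarithm (Bugeaud–Laurent two-log sharpenings, Kummer descent as in the tree's
SingleTowerSzpiro / KummerThird); the barrier's shape (1/3, 3) quantifies over ALL triples, the cell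
is where its p′-refinement (StewartYu2001 Thm 2, [corpus:paper:pasten2025 p.3 (1.2)]) is already
subexponential in rad^δ — the proved rung log c ≪ rad^(δ+ε) beats 1/3 on the cell for δ + ε < 1/3.
DeepTameForgivenABC is OUTSIDE (no logarithmic-form claim; it is the declared summit-carrying
residual).
- Literature.Barriers.ABC.EpsilonCannotBeDropped: honoured — both pieces keep 1+δ with K(δ); W at δ
≥ 1 is decided with K = 2 only because Q·rad = abc ≥ c there.
- Literature.Barriers.ABC.ExplicitABCQualityFloor: no explicit-constant claim on any piece; K(δ) is
ineffective in W and Baker-effective only in the rung.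
- Literature.Barriers.ABC.SzpiroEpsilonCannotBeDropped: not engaged — no Szpiro/conductor reading is
used.
- Literature.Barriers.ABC.HallExponentSharp: not engaged — no exponent-free (Hall-strength) claim on
any cell.
- Literature.Barriers.ABC.UniformABCDiscriminantSharp: not engaged — everything is over ℚ; the di

History (route lifecycle, newest last):
- 2026-08-30T21:37:40Z · RESIDUAL declared: DeepTameForgivenABC (stmt-ABC-29234) — summit-strength until shown otherwise: gate10 D-0170 bookkeeping: tribunal residual of record (TRIB-ABC-ROOTDECOMP-6); statement untouched; MIGRATION-PLAN-g22 (planner-decomp-abc-writer-1-g23-0)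
- 2026-09-04T10:18:01Z · DORMANT — reconciler: no traction for 5 d (last activity item-evidence-added at 2026-08-30T09:15:49Z); parked, not closed — `ledger route dormant route-ABC-RootDecompI -- (operator:999:2948093)

sub-problem: ABC · status: dormant · opened planner-decomp-abc-writer-1-g3-0 2026-08-30T06:22:32Z · rev 2 · ledger route-ABC-RootDecompI
GENERATED by the gate from the ledger (D-0016/17). Provers cite these decls: `theorem foo : Summit.ABC.ABC.Theses.RootDecompI.<Decl> := …` in Summits/ABC/ABC/Theorems/<Name>.lean.
-/

namespace Summit.ABC.ABC.Theses.RootDecompI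

open scoped BigOperators Topology Manifold Classical MeasureTheory ProbabilityTheory Matrix InnerProductSpace ComplexConjugate ContinuousMap
open Filter Set Function TopologicalSpace MeasureTheory

attribute [summit_statement] _root_.ABC

open Literature.Abc

/-- item stmt-ABC-29234 · crux · RESIDUAL (gen 0; summit-strength until shown otherwise, D-0170) · leaf IDEA-NEEDED · rank 2 · open · by planner
why it might fail: cannot fail unless abc fails (kernel deepTameForgiven_of_abc); as a TARGET it contains abc on every bounded-exponent cell (D's BoundedExponentABC, first open cell k = 3: Thue–Mahler territory) and on wild towers c = pⁿu, p > rad^δ; W(δ) is open for every δ < 1.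
sources: StewartYu2001, Yu2007, BombieriGubler2006, Granville1998, Pasten2024, EvertseGyory2015
[crux] for every δ > 0 there is K = K(δ) > 0 such that EVERY abc triple satisfies c < K · Q_δ(T) ·
rad(abc)^(1+δ), Q_δ(T) = ∏ over primes p | abc with p ≤ ⌊rad(abc)^δ⌋ of p^(ν_p(abc) − ⌈1/δ⌉)⁺
(deep-tame-forgiven abc; piece W, population-free; the declared RESIDUAL: W ⟹
RootDecompD.BoundedExponentABC in kernel, W(δ) decided for δ ≥ 1, open for every δ < 1).
[difficulty: open-problem] -/
@[route_item "route-ABC-RootDecompI"]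
def DeepTameForgivenABC : Prop :=
  ∀ δ : ℝ, 0 < δ → ∃ K : ℝ, 0 < K ∧ ∀ a b c : ℕ, Literature.NumberTheory.DiophantineGeometry.IsABCTriple a b c → (c : ℝ) < K * ((∏ p ∈ (a * b * c).primeFactors with p ≤ ⌊((Literature.NumberTheory.DiophantineGeometry.rad a b c : ℕ) : ℝ) ^ δ⌋₊, p ^ ((a * b * c).factorization p - ⌈δ⁻¹⌉₊) : ℕ) : ℝ) * ((Literature.NumberTheory.DiophantineGeometry.rad a b c : ℕ) : ℝ) ^ (1 + δ)

/-- item stmt-ABC-29235 · crux · leaf IDEA-NEEDED · rank 3 · open · by planner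
why it might fail: cannot fail unless abc fails (kernel); as a TARGET it contains MersenneRad-strength statements (abc on (1, 2ⁿ−1, 2ⁿ); Stewart 2013 gives far less) and the lift of the proved rung exp(K·rad^(δ+ε)) ↦ K·rad^(1+δ) sits inside BakerMethodBounds unless the depth > 1/δ of one cheap place is used.
sources: StewartYu2001, Yu2007, Stewart2013, BugeaudLaurent1996, Pasten2024, BakerWustholz2007
[crux] for every δ > 0 there is K = K(δ) > 0 such that every abc triple with c^δ ≤ Q_δ(T) (a tame
tower of depth > 1/δ carries c^δ) satisfies c < K · rad(abc)^(1+δ) — abc ON THE DEEP-TAME CELLS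
(piece H, the attacked conjunct; order-protected against identity-map re-entry; inhabited by the
infinite hit family (1, 2^(6k) − 1, 2^(6k)); rung DeepTameHeavySubexp PROVED). [difficulty:
open-problem] -/
@[route_item "route-ABC-RootDecompI"]
def DeepTameHeavyABC : Prop :=
  ∀ δ : ℝ, 0 < δ → ∃ K : ℝ, 0 < K ∧ ∀ a b c : ℕ, Literature.NumberTheory.DiophantineGeometry.IsABCTriple a b c → (c : ℝ) ^ δ ≤ ((∏ p ∈ (a * b * c).primeFactors with p ≤ ⌊((Literature.NumberTheory.DiophantineGeometry.rad a b c : ℕ) : ℝ) ^ δ⌋₊, p ^ ((a * b * c).factorization p - ⌈δ⁻¹⌉₊) : ℕ) : ℝ) → (c : ℝ) < K * ((Literature.NumberTheory.DiophantineGeometry.rad a b c : ℕ) : ℝ) ^ (1 + δ)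

/-- item stmt-ABC-29236 · aside · rank 9 · open · by planner
sources: StewartYu2001, Yu2007
[support] NAMED RUNG of H, PROVED: for every δ > 0 and ε > 0 there is K with log c < K ·
rad(abc)^(δ+ε) for every abc triple with c^δ ≤ Q_δ(T). Kernel: RootDecompA.CheapHeavySubexp
(stmt-ABC-26556) ⟹ it (DeepTameSplit.lean `deepTameHeavySubexp_of_cheapHeavySubexp`, cell inclusion
Q_δ ≤ E_δ ≤ S_δ) and UNCONDITIONALLY TameExcessSplitRung.lean `deepTameHeavySubexp_unconditional`
(Stewart–Yu place bounds via Summit.ABC.StewartYu.KummerThird + Theorems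
PadicPrimesKummerThirdY07Odd/Two; lean check rc 0 · 0 sorry · axioms
propext/Classical.choice/Quot.sound). Strictly below S's decided regime for δ + ε < 1/3; the cell is
infinite. Filed as an ASIDE at birth (outside the cone of closes, BC6); a prover lands the companion
under Summits/ABC/ABC/Theorems/ with --supports. [difficulty: provable-now] -/
@[route_item "route-ABC-RootDecompI"]
def DeepTameHeavySubexp : Prop :=
  ∀ δ : ℝ, 0 < δ → ∀ ε : ℝ, 0 < ε → ∃ K : ℝ, 0 < K ∧ ∀ a b c : ℕ, Literature.NumberTheory.DiophantineGeometry.IsABCTriple a b c → (c : ℝ) ^ δ ≤ ((∏ p ∈ (a * b * c).primeFactors with p ≤ ⌊((Literature.NumberTheory.DiophantineGeometry.rad a b c : ℕ) : ℝ) ^ δ⌋₊, p ^ ((a * b * c).factorization p - ⌈δ⁻¹⌉₊) : ℕ) : ℝ) → Real.log c < K * ((Literature.NumberTheory.DiophantineGeometry.rad a b c : ℕ) : ℝ) ^ (δ + ε)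

/-- item stmt-ABC-29873 · aside · rank 9 · open · by planner
sources: BakerWustholz2007
[aside — LEVER, not a piece of any closes] ARCHIMEDEAN Θ-LEVER ∃K ∃B: log c − log a < K·Λ^B·Y for
every abc triple (Λ = max(1, log rad(abc)), Y = log max(e, 2 log c)) = Baker–Wüstholz (ii) at the
one infinite place for the linear form log(b/c) in the primes of bc [BakerWustholz2007 §3.7 p.70].
TAGS (critic g2 l.424 O1): BELOW-abc (kernel archThetaLever_of_abc, B = 1) · UNDECIDED · lever; it
IMPLIES A's IDEA-NEEDED leaf LopsidedForgivenQuasiPoly stmt-ABC-24777 in kernel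
(lopsidedForgivenQuasiPoly_of_archThetaLever) — 24777 = B–W (ii) at ONE place and below abc. Shared
lever of the LFL roads (atlas NODE-g8 §3: 24777 KERNEL; 25919 / 26557 / I-29236-next SKETCH only —
not claimed). why it might fail: it is a uniform sharpening of linear forms in logarithms at the
archimedean place with polynomial dependence on log rad — open (Baker–Wüstholz desideratum (ii));
sources: BakerWustholz2007, lens-3 g8 BakerLeverAtlas. -/
@[route_item "route-ABC-RootDecompI"]
def ArchThetaLeverEx : Prop :=
  ∃ K B : ℝ, 0 < K ∧ 0 < B ∧ ∀ a b c : ℕ, Literature.NumberTheory.DiophantineGeometry.IsABCTriple a b c → Real.log c - Real.log a < K * (max 1 (Real.log ((Literature.NumberTheory.DiophantineGeometry.rad a b c : ℕ) : ℝ))) ^ B * Real.log (max (Real.exp 1) (2 * Real.log c))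

/-- item stmt-ABC-29874 · aside · rank 9 · open · by planner
sources: BakerWustholz2007, Yu2007
[aside — LEVER, not a piece of any closes] p-ADIC Θ-LEVER at σ = 1 ∃K ∃B: for every abc triple and
every prime p | a (resp. p | c), ν_p(a)·log p (resp. ν_p(c)·log p) < K·Λ^B·(p/log p)·(log p + Y) (Λ
= max(1, log rad), Y = log max(e, 2 log c)) = Baker–Wüstholz (ii) p-adically (Yu's estimate with the
sum of heights replaced by K·Λ^B). TAGS (critic g2 l.424 O1 — the lens's «ROAD / NOT abc-implied»
tag is KERNEL-REFUTED: abc → ∃K>0, PadicThetaLever K 1 σ for every σ ≥ 0 by the three-line size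
argument, certificate critic/L3g8_PadicThetaBelowABC.lean 9870a678…): BELOW-abc (kernel) · UNDECIDED
· lever; it IMPLIES A's typed next rung SmoothHeavyQuasiPoly in kernel
(smoothHeavyQuasiPoly_of_padicThetaLever). The two Θ-levers differ only by WHICH places are levered
(the atlas's species split by abc-implication collapses); the θ_bc-currency PLACE bounds
PadicPlaceBoundSigma K σ, σ < 1, are a different matter (no necessity proof either way; not items);
carrier law bakerShapeBound_sigma_third: a σ-dial gives global exponent σ/3, never PolyABC for σ > 0
(negative guidance). why it might fail: uniform p-adic linear forms with polynomial dependence on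
log rad at every place — open; sources: BakerW -/
@[route_item "route-ABC-RootDecompI"]
def PadicThetaLeverEx : Prop :=
  ∃ K B : ℝ, 0 < K ∧ 0 < B ∧ (∀ a b c : ℕ, Literature.NumberTheory.DiophantineGeometry.IsABCTriple a b c → ∀ p : ℕ, p.Prime → p ∣ a → (a.factorization p : ℝ) * Real.log p < K * (max 1 (Real.log ((Literature.NumberTheory.DiophantineGeometry.rad a b c : ℕ) : ℝ))) ^ B * (((p : ℝ) ^ (1 : ℝ) / Real.log p) * (Real.log p + Real.log (max (Real.exp 1) (2 * Real.log c))))) ∧ (∀ a b c : ℕ, Literature.NumberTheory.DiophantineGeometry.IsABCTriple a b c → ∀ p : ℕ, p.Prime → p ∣ c → (c.factorization p : ℝ) * Real.log p < K * (max 1 (Real.log ((Literature.NumberTheory.DiophantineGeometry.rad a b c : ℕ) : ℝ))) ^ B * (((p : ℝ) ^ (1 : ℝ) / Real.log p) * (Real.log p + Real.log (max (Real.exp 1) (2 * Real.log c)))))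

/-- item stmt-ABC-30978 · aside · rank 9 · open · by planner
why it might fail: As a statement it is implied by ABC (kernel), so it fails only if abc fails on a lopsided, crowded, Kummer-generic triple; as a ROAD it has none: no engine bites cells that exclude smooth/lone/bounded-shape members, and for κ ≥ 1.5 the hit tables are empty (R-EMPTY hazard inherited from 30330).
sources: lens-4 g9 OrphanCore.lean + NODE-g9.md (decomp-abc bus), StewartYu2001, Baker2004abc, doi:10.1017/cbo9780511618314 §7.1 (ψ(x,y))
[aside · COMMON RESIDUAL SPECIES of the root doors · tag of record HONEST-NEGATIVE-mod-∀-families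
(BE, LopFew)] abc, FORGIVEN as door I (factor ∏_{p ≤ rad^ε} p^{(v_p − ⌈1/ε⌉)⁺}), on the ORPHAN CELL
{c ≤ K·N₅(abc)⁴ ∧ c ≤ K·N₄(abc)⁵ ∧ min(a,b) ≤ c^{1−ε} ∧ every member has ≥ 2 primes > (log c)^κ} (∀K
∀ε>0 ∃κ ∃C). KERNEL (lens-4 g9 OrphanCore.lean ebdf3ca86b9c…, 0 sorry, std axioms): implied by EACH
live residual — B LopKummerCell5 (28112), G LopKummerCell4 (28097), K CrowdedMembersFloorABC
(30330), I DeepTameForgivenABC (29234) — and by ABC; conversely with the doors' STRUCTURED pieces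
(KummerFloor5, KummerFloor4, BalKummerCell5, SmoothMemberCellsABC, LoneLargePrimeCellsABC,
DeepTameHeavyABC) it implies ABC (abc_of_pieces_of_orphanCore): the doors jointly reduce abc to
exactly this. POPULATED: 3 kernel witnesses at K=1, κ=1 (q ≈ 1.187, 1.154 at ε=1/20; q ≈ 1.358 at
ε=1/60), 99 census hits at ε=1/20 (c up to 10^63); B/G residuals strictly larger (Reyssat, kernel);
A's live residual 27608 disjoint. ≡ S: UNDECIDED (critic l.493: no identity CERTIFIES membership of
its image in the cell — N_sf / N₅ / N₄ of the fresh factor bounded only from below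
(transport-blindness); crowdedness of the -/
@[route_item "route-ABC-RootDecompI"]
def OrphanCore : Prop :=
  ∀ K : ℕ, ∀ ε : ℝ, 0 < ε → ∃ κ : ℝ, ∃ C : ℝ, 0 < C ∧ ∀ a b c : ℕ, Literature.NumberTheory.DiophantineGeometry.IsABCTriple a b c → c ≤ K * ((a * b * c).primeFactors.filter (fun p => ¬ 5 ∣ (a * b * c).factorization p)).prod (fun p => p) ^ 4 → c ≤ K * ((a * b * c).primeFactors.filter (fun p => ¬ 4 ∣ (a * b * c).factorization p)).prod (fun p => p) ^ 5 → ((min a b : ℕ) : ℝ) ≤ (c : ℝ) ^ (1 - ε) → 2 ≤ (a.primeFactors.filter (fun p : ℕ => Real.log (c : ℝ) ^ κ < (p : ℝ))).card → 2 ≤ (b.primeFactors.filter (fun p : ℕ => Real.log (c : ℝ) ^ κ < (p : ℝ))).card → 2 ≤ (c.primeFactors.filter (fun p : ℕ => Real.log (c : ℝ) ^ κ < (p : ℝ))).card → (c : ℝ) < C * ((∏ p ∈ (a * b * c).primeFactors with p ≤ ⌊((Literature.NumberTheory.DiophantineGeometry.rad a b c : ℕ) : ℝ) ^ ε⌋₊,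 p ^ ((a * b * c).factorization p - ⌈ε⁻¹⌉₊) : ℕ) : ℝ) * ((Literature.NumberTheory.DiophantineGeometry.rad a b c : ℕ) : ℝ) ^ (1 + ε)

/-- item stmt-ABC-29237 · assembly · rank 1 · open · by planner
sources: StewartYu2001, Granville1998
[assembly] DeepTameForgivenABC → DeepTameHeavyABC → abc (the deciding theorem `closes` of glue.lean
is the kernel proof; exact node, kernel `node_iff`). -/
@[route_item "route-ABC-RootDecompI"]
def Assembly : Prop :=
  DeepTameForgivenABC → DeepTameHeavyABC → _root_.ABC

/-! D-0027 §2.1 — DECIDING THEOREM (planner-authored via `route open/edit --closes-file`; by planner-decomp-abc-writer-1-g3-0 2026-08-30T06:22:32Z):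
its hypotheses are this route's items and its conclusion the sub-problem Statement (glue_lint), and it elaborates with this file. -/

@[closes "route-ABC-RootDecompI"] theorem closes (hW : DeepTameForgivenABC) (hH : DeepTameHeavyABC) : _root_.ABC := by
  rw [_root_.ABC_iff]
  have one_le_rad : ∀ a b c : ℕ,
      (1 : ℝ) ≤ ((Literature.NumberTheory.DiophantineGeometry.rad a b c : ℕ) : ℝ) := by
    intro a b c
    have h0 : (Literature.NumberTheory.DiophantineGeometry.rad a b c : ℕ) ≠ 0 := by
      rw [Literature.NumberTheory.DiophantineGeometry.rad_def]
      exact UniqueFactorizationMonoid.radical_ne_zero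
    exact_mod_cast Nat.one_le_iff_ne_zero.mpr h0
  suffices main : ∀ ε : ℝ, 0 < ε → ε ≤ 1 → ∃ C : ℝ, 0 < C ∧ ∀ a b c : ℕ,
      Literature.NumberTheory.DiophantineGeometry.IsABCTriple a b c →
      (c : ℝ) < C * ((Literature.NumberTheory.DiophantineGeometry.rad a b c : ℕ) : ℝ) ^ (1 + ε) by
    intro ε hε
    obtain ⟨C, hC, h⟩ := main (min ε 1) (lt_min hε one_pos) (min_le_right _ _)
    refine ⟨C, hC, fun a b c habc => (h a b c habc).trans_le ?_⟩
    exact mul_le_mul_of_nonneg_left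
      (Real.rpow_le_rpow_of_exponent_le (one_le_rad a b c) (by linarith [min_le_left ε 1])) hC.le
  intro ε hε hε1
  obtain ⟨K₁, hK₁, h₁⟩ := hH (ε / 3) (by positivity)
  obtain ⟨K₂, hK₂, h₂⟩ := hW (ε / 3) (by positivity)
  have hη1 : 0 < 1 - ε / 3 := by linarith
  have hexpo : (1 + ε / 3) * (1 - ε / 3)⁻¹ ≤ 1 + ε := by
    rw [← div_eq_mul_inv, div_le_iff₀ hη1]
    nlinarith
  refine ⟨max K₁ (K₂ ^ (1 - ε / 3)⁻¹), lt_max_of_lt_left hK₁, fun a b c habc => ?_⟩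
  have hR := one_le_rad a b c
  have hR0 : (0 : ℝ) ≤ ((Literature.NumberTheory.DiophantineGeometry.rad a b c : ℕ) : ℝ) := by linarith
  have hc0 : (0 : ℝ) < (c : ℝ) := by
    obtain ⟨ha, -, hab, -⟩ := habc
    exact_mod_cast (show 0 < c by omega)
  have hRε : ((Literature.NumberTheory.DiophantineGeometry.rad a b c : ℕ) : ℝ) ^ (1 + ε / 3) ≤
      ((Literature.NumberTheory.DiophantineGeometry.rad a b c : ℕ) : ℝ) ^ (1 + ε) :=
    Real.rpow_le_rpow_of_exponent_le hR (by linarith)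
  have hRpos : (0 : ℝ) < ((Literature.NumberTheory.DiophantineGeometry.rad a b c : ℕ) : ℝ) ^ (1 + ε) :=
    Real.rpow_pos_of_pos (by linarith) _
  by_cases hcell : (c : ℝ) ^ (ε / 3) ≤
      ((∏ p ∈ (a * b * c).primeFactors with
          p ≤ ⌊((Literature.NumberTheory.DiophantineGeometry.rad a b c : ℕ) : ℝ) ^ (ε / 3)⌋₊,
          p ^ ((a * b * c).factorization p - ⌈(ε / 3)⁻¹⌉₊) : ℕ) : ℝ)
  · calc (c : ℝ) < K₁ * ((Literature.NumberTheory.DiophantineGeometry.rad a b c : ℕ) : ℝ) ^ (1 + ε / 3) :=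
          h₁ a b c habc hcell
      _ ≤ K₁ * ((Literature.NumberTheory.DiophantineGeometry.rad a b c : ℕ) : ℝ) ^ (1 + ε) :=
          mul_le_mul_of_nonneg_left hRε hK₁.le
      _ ≤ max K₁ (K₂ ^ (1 - ε / 3)⁻¹) *
            ((Literature.NumberTheory.DiophantineGeometry.rad a b c : ℕ) : ℝ) ^ (1 + ε) :=
          mul_le_mul_of_nonneg_right (le_max_left _ _) hRpos.le
  · push Not at hcell
    have hcη : 0 < (c : ℝ) ^ (ε / 3) := Real.rpow_pos_of_pos hc0 _
    have hR3 : 0 < ((Literature.NumberTheory.DiophantineGeometry.rad a b c : ℕ) : ℝ) ^ (1 + ε / 3) :=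
      Real.rpow_pos_of_pos (by linarith) _
    have hlt : (c : ℝ) < K₂ * (c : ℝ) ^ (ε / 3) *
        ((Literature.NumberTheory.DiophantineGeometry.rad a b c : ℕ) : ℝ) ^ (1 + ε / 3) := by
      calc (c : ℝ) < K₂ * ((∏ p ∈ (a * b * c).primeFactors with
              p ≤ ⌊((Literature.NumberTheory.DiophantineGeometry.rad a b c : ℕ) : ℝ) ^ (ε / 3)⌋₊,
              p ^ ((a * b * c).factorization p - ⌈(ε / 3)⁻¹⌉₊) : ℕ) : ℝ) *
            ((Literature.NumberTheory.DiophantineGeometry.rad a b c : ℕ) : ℝ) ^ (1 + ε / 3) := h₂ a b c habc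
        _ ≤ K₂ * (c : ℝ) ^ (ε / 3) *
            ((Literature.NumberTheory.DiophantineGeometry.rad a b c : ℕ) : ℝ) ^ (1 + ε / 3) := by gcongr
    have hpow : (c : ℝ) ^ (1 - ε / 3) <
        K₂ * ((Literature.NumberTheory.DiophantineGeometry.rad a b c : ℕ) : ℝ) ^ (1 + ε / 3) := by
      rw [Real.rpow_sub hc0, Real.rpow_one, div_lt_iff₀ hcη]
      calc (c : ℝ) < K₂ * (c : ℝ) ^ (ε / 3) *
            ((Literature.NumberTheory.DiophantineGeometry.rad a b c : ℕ) : ℝ) ^ (1 + ε / 3) := hlt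
        _ = K₂ * ((Literature.NumberTheory.DiophantineGeometry.rad a b c : ℕ) : ℝ) ^ (1 + ε / 3) *
            (c : ℝ) ^ (ε / 3) := by ring
    have hinv : 0 < (1 - ε / 3)⁻¹ := inv_pos.mpr hη1
    have hc1η : 0 ≤ (c : ℝ) ^ (1 - ε / 3) := (Real.rpow_pos_of_pos hc0 _).le
    have hroot : (c : ℝ) = ((c : ℝ) ^ (1 - ε / 3)) ^ (1 - ε / 3)⁻¹ :=
      (Real.rpow_rpow_inv hc0.le hη1.ne').symm
    have hstep : ((c : ℝ) ^ (1 - ε / 3)) ^ (1 - ε / 3)⁻¹ <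
        (K₂ * ((Literature.NumberTheory.DiophantineGeometry.rad a b c : ℕ) : ℝ) ^ (1 + ε / 3)) ^
          (1 - ε / 3)⁻¹ :=
      Real.rpow_lt_rpow hc1η hpow hinv
    have hsplit : (K₂ * ((Literature.NumberTheory.DiophantineGeometry.rad a b c : ℕ) : ℝ) ^ (1 + ε / 3)) ^
          (1 - ε / 3)⁻¹ =
        K₂ ^ (1 - ε / 3)⁻¹ *
          ((Literature.NumberTheory.DiophantineGeometry.rad a b c : ℕ) : ℝ) ^ ((1 + ε / 3) * (1 - ε / 3)⁻¹) := by
      rw [Real.mul_rpow hK₂.le hR3.le, ← Real.rpow_mul hR0]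
    have hexp : ((Literature.NumberTheory.DiophantineGeometry.rad a b c : ℕ) : ℝ) ^ ((1 + ε / 3) * (1 - ε / 3)⁻¹) ≤
        ((Literature.NumberTheory.DiophantineGeometry.rad a b c : ℕ) : ℝ) ^ (1 + ε) :=
      Real.rpow_le_rpow_of_exponent_le hR hexpo
    have hK₂' : 0 ≤ K₂ ^ (1 - ε / 3)⁻¹ := (Real.rpow_pos_of_pos hK₂ _).le
    calc (c : ℝ) = ((c : ℝ) ^ (1 - ε / 3)) ^ (1 - ε / 3)⁻¹ := hroot
      _ < (K₂ * ((Literature.NumberTheory.DiophantineGeometry.rad a b c : ℕ) : ℝ) ^ (1 + ε / 3)) ^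
            (1 - ε / 3)⁻¹ := hstep
      _ = K₂ ^ (1 - ε / 3)⁻¹ *
            ((Literature.NumberTheory.DiophantineGeometry.rad a b c : ℕ) : ℝ) ^ ((1 + ε / 3) * (1 - ε / 3)⁻¹) :=
          hsplit
      _ ≤ K₂ ^ (1 - ε / 3)⁻¹ *
            ((Literature.NumberTheory.DiophantineGeometry.rad a b c : ℕ) : ℝ) ^ (1 + ε) :=
          mul_le_mul_of_nonneg_left hexp hK₂'
      _ ≤ max K₁ (K₂ ^ (1 - ε / 3)⁻¹) *
            ((Literature.NumberTheory.DiophantineGeometry.rad a b c : ℕ) : ℝ) ^ (1 + ε) :=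
          mul_le_mul_of_nonneg_right (le_max_right _ _) hRpos.le

end Summit.ABC.ABC.Theses.RootDecompI
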